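import Mathlib
import Literature.Analysis.FluidPDE.AxisymmetricEuler
import Literature.Analysis.FluidPDE.TypeIAncientMildRescale
import Literature.Analysis.FluidPDE.NSBoundedMildSmoothing
import Summits.NavierStokesRegularity.NavierStokesRegularity.Theorems.PoloidalWindowDoorPoloidalWindowRigidityPeriodic

/-!
# Crux `PoloidalWindowRigidity` (K2, stmt-NavierStokesRegularity-19708) — LINE 30 `point_group`, ANNEX `point_group_centre` (0 sorry; general class)
# (IDEATOR seat ns-idea-8, generation 13)

ONE CENTRE (PROVED, unconditional, in the GENERAL Type-I ancient mild class — no pins): if a NON-TRIVIAL Type-I ancient mild field is invariant under two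
affine vertical similarities `y ↦ λᵢ R_{θᵢ} y + bᵢ` with `λ₁, λ₂ ≠ 1` (screw-SCALINGS about their unique fixed points = centres), the two centres coincide.
Lever: the COMMUTATOR of two affine vertical similarities is a pure TRANSLATION symmetry (their linear parts `λR_θ` commute), i.e. a spatial PERIOD of
every slice, which the tree's periodic stratum `Theorems.PoloidalWindowDoorPoloidalWindowRigidityPeriodic.eq_zero_of_spatiallyPeriodic` (KNSS line
invariant) kills; with the translation part zero the two maps commute, so `g₂ c₁` is a fixed point of `g₁`, hence `= c₁`, hence `c₁ = c₂`.
Nearest tree items (cited, not used): census `ScenarioCensus.RotationOrderAxis.Row_ApaT` / `Row_AdsT` / `axis_unique_of_nontrivial` /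
`centre_on_axis_of_nontrivial` (two parallel ROTATION axes; DSS centre off a rotation axis) — the same commutator-is-a-translation move for rotations;
this annex does it for two SCALING centres with arbitrary angles.  Folklore-level; filed as the annex of LINE 30 so that the main file stays under the
byte cap.  LABELS: files-only; no cell / crux / route item closed; 19708 / 20428 OPEN; NS regularity NOT proved.
-/
noncomputable section

set_option linter.dupNamespace false
set_option linter.unusedVariables false

namespace Summit.NavierStokesRegularity.NavierStokesRegularity.Cruxes.PoloidalWindowRigidity.PointGroup.Centre

open Set Function Filter Topology Metric
open Literature.Analysis Literature.Analysis.FluidPDE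
open Summit.NavierStokesRegularity.NavierStokesRegularity.Theorems

/-- `R_θ` commutes with scalars (re-proved; light). -/
theorem rotZ_smul' (θ c : ℝ) (x : EuclideanSpace ℝ (Fin 3)) : rotZ θ (c • x) = c • rotZ θ x := by
  ext i
  fin_cases i <;> simp <;> ring

/-- `R_θ R_{−θ} = id`. -/
theorem rotZ_rotZ_neg' (θ : ℝ) (x : EuclideanSpace ℝ (Fin 3)) : rotZ θ (rotZ (-θ) x) = x := by
  rw [← rotZ_add, add_neg_cancel, rotZ_zero]

/-- `R_θ` is additive. -/
theorem rotZ_add_vec' (θ : ℝ) (x y : EuclideanSpace ℝ (Fin 3)) : rotZ θ (x + y) = rotZ θ x + rotZ θ y := by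
  ext i
  fin_cases i <;> simp <;> ring

/-- `R_θ` respects differences. -/
theorem rotZ_sub_vec' (θ : ℝ) (x y : EuclideanSpace ℝ (Fin 3)) : rotZ θ (x - y) = rotZ θ x - rotZ θ y := by
  ext i
  fin_cases i <;> simp <;> ring

/-- Rotations about one axis commute. -/
theorem rotZ_comm' (θ φ : ℝ) (x : EuclideanSpace ℝ (Fin 3)) : rotZ θ (rotZ φ x) = rotZ φ (rotZ θ x) := by
  rw [← rotZ_add, add_comm, rotZ_add]

/-- **Affine vertical similarity invariance** `v(t,y) = λ R_{−θ} v(λ² t, λ R_θ y + b)`: the general element of the group generated by translations, vertical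
rotations and parabolic scalings (its elements with `λ ≠ 1` are the screw-scalings about their unique fixed point). -/
def IsSim (b : EuclideanSpace ℝ (Fin 3)) (θ lam : ℝ) (v : ℝ → EuclideanSpace ℝ (Fin 3) → EuclideanSpace ℝ (Fin 3)) : Prop :=
  ∀ t < 0, ∀ y, v t y = lam • rotZ (-θ) (v (lam ^ 2 * t) (lam • rotZ θ y + b))

/-- **THE COMMUTATOR LEMMA (PROVED):** two affine vertical similarities of one profile differ by a TRANSLATION symmetry — their linear parts commute, so
`g₁g₂g₁⁻¹g₂⁻¹` is the translation by `(λ₂R₂b₁ + b₂) − (λ₁R₁b₂ + b₁)`, a spatial PERIOD of every slice. -/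
theorem translate_of_two_sims {b₁ b₂ : EuclideanSpace ℝ (Fin 3)} {θ₁ θ₂ l₁ l₂ : ℝ} {v : ℝ → EuclideanSpace ℝ (Fin 3) → EuclideanSpace ℝ (Fin 3)}
    (h1 : IsSim b₁ θ₁ l₁ v) (h2 : IsSim b₂ θ₂ l₂ v) (hl₁ : 0 < l₁) (hl₂ : 0 < l₂) :
    ∀ s < 0, ∀ z, v s (z + ((l₂ • rotZ θ₂ b₁ + b₂) - (l₁ • rotZ θ₁ b₂ + b₁))) = v s z := by
  have hl : 0 < l₁ * l₂ := mul_pos hl₁ hl₂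
  -- cancelling the common linear part of the two double expansions
  have hXY : ∀ X Y : EuclideanSpace ℝ (Fin 3),
      l₁ • rotZ (-θ₁) (l₂ • rotZ (-θ₂) X) = l₂ • rotZ (-θ₂) (l₁ • rotZ (-θ₁) Y) → X = Y := by
    intro X Y hxy
    simp only [rotZ_smul', smul_smul] at hxy
    rw [mul_comm l₂ l₁, rotZ_comm' (-θ₂) (-θ₁)] at hxy
    have h3 := smul_right_injective _ hl.ne' hxy
    have h4 := congrArg (fun w => rotZ θ₂ (rotZ θ₁ w)) h3
    simpa only [rotZ_rotZ_neg'] using h4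
  -- both double expansions at `(t, y)`, `t = s/(l₁l₂)²`
  have hA : ∀ s < 0, ∀ y, v s ((l₁ * l₂) • rotZ (θ₁ + θ₂) y + (l₂ • rotZ θ₂ b₁ + b₂)) =
      v s ((l₁ * l₂) • rotZ (θ₁ + θ₂) y + (l₁ • rotZ θ₁ b₂ + b₁)) := by
    intro s hs y
    set t : ℝ := s / (l₁ * l₂) ^ 2 with ht_def
    have ht : t < 0 := div_neg_of_neg_of_pos hs (pow_pos hl 2)
    have h1t : l₁ ^ 2 * t < 0 := mul_neg_of_pos_of_neg (pow_pos hl₁ 2) ht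
    have h2t : l₂ ^ 2 * t < 0 := mul_neg_of_pos_of_neg (pow_pos hl₂ 2) ht
    have E1 := h1 t ht y
    rw [h2 _ h1t (l₁ • rotZ θ₁ y + b₁)] at E1
    have E2 := h2 t ht y
    rw [h1 _ h2t (l₂ • rotZ θ₂ y + b₂)] at E2
    have E := hXY _ _ (E1.symm.trans E2)
    have et1 : l₂ ^ 2 * (l₁ ^ 2 * t) = s := by rw [ht_def]; field_simp
    have et2 : l₁ ^ 2 * (l₂ ^ 2 * t) = s := by rw [ht_def]; field_simp
    have ea1 : l₂ • rotZ θ₂ (l₁ • rotZ θ₁ y + b₁) + b₂ = (l₁ * l₂) • rotZ (θ₁ + θ₂) y + (l₂ • rotZ θ₂ b₁ + b₂) := by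
      rw [rotZ_add_vec', rotZ_smul', smul_add, smul_smul, mul_comm l₂ l₁, ← rotZ_add, add_comm θ₂ θ₁, add_assoc]
    have ea2 : l₁ • rotZ θ₁ (l₂ • rotZ θ₂ y + b₂) + b₁ = (l₁ * l₂) • rotZ (θ₁ + θ₂) y + (l₁ • rotZ θ₁ b₂ + b₁) := by
      rw [rotZ_add_vec', rotZ_smul', smul_add, smul_smul, ← rotZ_add, add_assoc]
    rw [et1, et2, ea1, ea2] at E
    exact E
  intro s hs z
  have key := hA s hs ((l₁ * l₂)⁻¹ • rotZ (-(θ₁ + θ₂)) (z - (l₁ • rotZ θ₁ b₂ + b₁)))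
  have e : (l₁ * l₂) • rotZ (θ₁ + θ₂) ((l₁ * l₂)⁻¹ • rotZ (-(θ₁ + θ₂)) (z - (l₁ • rotZ θ₁ b₂ + b₁))) = z - (l₁ • rotZ θ₁ b₂ + b₁) := by
    rw [rotZ_smul', smul_smul, mul_inv_cancel₀ hl.ne', one_smul, rotZ_rotZ_neg']
  rw [e, sub_add_cancel] at key
  have e2 : z - (l₁ • rotZ θ₁ b₂ + b₁) + (l₂ • rotZ θ₂ b₁ + b₂) = z + ((l₂ • rotZ θ₂ b₁ + b₂) - (l₁ • rotZ θ₁ b₂ + b₁)) := by abel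
  rw [e2] at key
  exact key

/-- An affine vertical similarity with factor `λ ≠ 1` has at most one fixed point (`λR_θ − I` is injective: `‖λR_θ x‖ = λ‖x‖`). -/
theorem sim_fixedPoint_unique {b : EuclideanSpace ℝ (Fin 3)} {θ lam : ℝ} (hl0 : 0 < lam) (hl1 : lam ≠ 1) {x y : EuclideanSpace ℝ (Fin 3)}
    (hx : lam • rotZ θ x + b = x) (hy : lam • rotZ θ y + b = y) : x = y := by
  have h1 : lam • rotZ θ (x - y) = x - y := by
    calc lam • rotZ θ (x - y) = (lam • rotZ θ x + b) - (lam • rotZ θ y + b) := by rw [rotZ_sub_vec', smul_sub]; abel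
      _ = x - y := by rw [hx, hy]
  have h2 : lam * ‖x - y‖ = ‖x - y‖ := by
    have h := congrArg norm h1
    rwa [norm_smul, Real.norm_eq_abs, abs_of_pos hl0, norm_rotZ] at h
  have h4 : (lam - 1) * ‖x - y‖ = 0 := by rw [sub_mul, one_mul, h2, sub_self]
  rcases mul_eq_zero.1 h4 with h5 | h5
  · exact absurd (sub_eq_zero.1 h5) hl1
  · exact sub_eq_zero.1 (norm_eq_zero.1 h5)

/-- **ONE CENTRE (PROVED, unconditional, general class).**  A Type-I ancient mild field invariant under two affine vertical similarities with factors
`λ₁, λ₂ ≠ 1` whose fixed points (centres) DIFFER vanishes identically on the past: the commutator is a NONZERO period. -/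
theorem eq_zero_of_two_centres {C : ℝ} {v : ℝ → EuclideanSpace ℝ (Fin 3) → EuclideanSpace ℝ (Fin 3)} (hv : IsTypeIAncientMild C v)
    {b₁ b₂ c₁ c₂ : EuclideanSpace ℝ (Fin 3)} {θ₁ θ₂ l₁ l₂ : ℝ} (hl₁ : 0 < l₁) (hl₂ : 0 < l₂) (h1 : l₁ ≠ 1) (h2 : l₂ ≠ 1)
    (hs1 : IsSim b₁ θ₁ l₁ v) (hs2 : IsSim b₂ θ₂ l₂ v) (fix1 : l₁ • rotZ θ₁ c₁ + b₁ = c₁) (fix2 : l₂ • rotZ θ₂ c₂ + b₂ = c₂) (hne : c₁ ≠ c₂) :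
    ∀ t < 0, ∀ x, v t x = 0 := by
  by_contra hv0
  -- the commutator translation must vanish, else the periodic stratum kills `v`
  have hu : (l₂ • rotZ θ₂ b₁ + b₂) - (l₁ • rotZ θ₁ b₂ + b₁) = 0 := by
    by_contra hne'
    exact hv0 (PoloidalWindowDoorPoloidalWindowRigidityPeriodic.eq_zero_of_spatiallyPeriodic hv.2.2.2 hv.1.continuousOn
      (fun s t hst ht x => hv.mild_eq_heatExtension hst ht x) hv.2.1 hne' (translate_of_two_sims hs1 hs2 hl₁ hl₂))
  have hu' : l₂ • rotZ θ₂ b₁ + b₂ = l₁ • rotZ θ₁ b₂ + b₁ := sub_eq_zero.1 hu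
  -- `g₂ c₁` is a fixed point of `g₁`
  have fix3 : l₁ • rotZ θ₁ (l₂ • rotZ θ₂ c₁ + b₂) + b₁ = l₂ • rotZ θ₂ c₁ + b₂ := by
    have ea2 : l₁ • rotZ θ₁ (l₂ • rotZ θ₂ c₁ + b₂) + b₁ = (l₁ * l₂) • rotZ (θ₁ + θ₂) c₁ + (l₁ • rotZ θ₁ b₂ + b₁) := by
      rw [rotZ_add_vec', rotZ_smul', smul_add, smul_smul, ← rotZ_add, add_assoc]
    have ea1 : l₂ • rotZ θ₂ (l₁ • rotZ θ₁ c₁ + b₁) + b₂ = (l₁ * l₂) • rotZ (θ₁ + θ₂) c₁ + (l₂ • rotZ θ₂ b₁ + b₂) := by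
      rw [rotZ_add_vec', rotZ_smul', smul_add, smul_smul, mul_comm l₂ l₁, ← rotZ_add, add_comm θ₂ θ₁, add_assoc]
    rw [ea2, ← hu', ← ea1, fix1]
  have e1 : l₂ • rotZ θ₂ c₁ + b₂ = c₁ := sim_fixedPoint_unique hl₁ h1 fix3 fix1
  exact hne (sim_fixedPoint_unique hl₂ h2 e1 fix2)

/-- **Screw-scaling form.**  Invariance `v(t, x + c) = λ R_{−θ} v(λ²t, λ R_θ x + c)` about the centre `c` (LINE 29's `IsScrewAbout c θ λ v`, spelled out) is
the affine similarity with `b = c − λ R_θ c`, whose fixed point is `c`; so two such invariances with `λᵢ ≠ 1` about DIFFERENT centres force `v ≡ 0`. -/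
theorem eq_zero_of_two_screw_centres {C : ℝ} {v : ℝ → EuclideanSpace ℝ (Fin 3) → EuclideanSpace ℝ (Fin 3)} (hv : IsTypeIAncientMild C v)
    {c₁ c₂ : EuclideanSpace ℝ (Fin 3)} {θ₁ θ₂ l₁ l₂ : ℝ} (hl₁ : 0 < l₁) (hl₂ : 0 < l₂) (h1 : l₁ ≠ 1) (h2 : l₂ ≠ 1)
    (hs1 : ∀ t < 0, ∀ x, v t (x + c₁) = l₁ • rotZ (-θ₁) (v (l₁ ^ 2 * t) (l₁ • rotZ θ₁ x + c₁)))
    (hs2 : ∀ t < 0, ∀ x, v t (x + c₂) = l₂ • rotZ (-θ₂) (v (l₂ ^ 2 * t) (l₂ • rotZ θ₂ x + c₂))) (hne : c₁ ≠ c₂) :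
    ∀ t < 0, ∀ x, v t x = 0 := by
  have toSim : ∀ {c : EuclideanSpace ℝ (Fin 3)} {θ lam : ℝ},
      (∀ t < 0, ∀ x, v t (x + c) = lam • rotZ (-θ) (v (lam ^ 2 * t) (lam • rotZ θ x + c))) → IsSim (c - lam • rotZ θ c) θ lam v := by
    intro c θ lam h t ht y
    have key := h t ht (y - c)
    simp only [sub_add_cancel] at key
    have e : lam • rotZ θ (y - c) + c = lam • rotZ θ y + (c - lam • rotZ θ c) := by
      rw [rotZ_sub_vec', smul_sub]; abel
    rw [key, e]
  exact eq_zero_of_two_centres hv hl₁ hl₂ h1 h2 (toSim hs1) (toSim hs2) (by abel) (by abel) hne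

end Summit.NavierStokesRegularity.NavierStokesRegularity.Cruxes.PoloidalWindowRigidity.PointGroup.Centre
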